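import Summits.QuantumAdvantage.QuantumAdvantage.Theorems.SosSandwichTransferPBDefs
import Summits.QuantumAdvantage.QuantumAdvantage.Theorems.SosSandwichTransferPBStubOracleAcceptPseudoBounded
import Summits.QuantumAdvantage.QuantumAdvantage.Theorems.SosSandwichTransferPBSimTreeOnPB

/-!
# Crux `TransferPB` (stmt-QuantumAdvantage-15238, route SosSandwich), line `birth` — the query half of `stub_pbOracleSimulation` from the crux's own antecedent

`Sig.stub_pbOracleSimulation` is `Sig.stub_oracleAcceptPseudoBounded → PseudoBoundedAA → OracleSimulation`.
Stub 1 is LANDED (`stub_oracleAcceptPseudoBounded`, `Theorems/SosSandwichTransferPBStubOracleAcceptPseudoBounded.lean`),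
so the query half of Aaronson–Ambainis' Thm. 23 now follows from the route's antecedent `PseudoBoundedAA` ALONE
(by name): `PseudoBoundedAA` unpacks definitionally to the PB-AA influence bound in the tree's vocabulary
(`pbInfluenceBound_of_pseudoBoundedAA`), and `Theorems/SosSandwichTransferPBSimTreeOnPB.lean` does the rest.

* `pbInfluenceBound_of_pseudoBoundedAA` — `PseudoBoundedAA` in the vocabulary `PseudoBounded` /
  `boolVariance` / `influence` (definitional unpacking of the route's inline `let ev … let avg …`);
* **`queryHalf_of_pseudoBoundedAA`** — granted PB-AA there are constants `c, C₀ > 0` such that for EVERY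
  Clifford+T oracle family `F`, input `x` and `ε, δ ∈ (0,1]`, the simulation tree on `p_x` deviates from
  `p_x(A) = Pr[F^A accepts x]` by more than `ε` with random-oracle probability `≤ δ`;
* `apxThreshold_of_pseudoBoundedAA` — and the tree's explicit `simTreeOn c C₀ F x` satisfies the thresholded
  claim (apx) (`< 1/n³`) for `|x| ≥ 1`.

What remains for the stub is the MACHINE half only (see the module docstring of `…SimTreeOnPB.lean`).
Source: S. Aaronson, A. Ambainis, Theory Comput. 10 (2014), Thm. 23 and its proof (arXiv:0911.0996v3 p. 14).
-/

-- D-0017: single-conjunct summit ⇒ the duplicate `QuantumAdvantage.QuantumAdvantage` is mandated.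
set_option linter.dupNamespace false

noncomputable section

namespace Summit.QuantumAdvantage.QuantumAdvantage.Cruxes.TransferPB.Birth

open MeasureTheory Literature.Computability.Cryptography Literature.Computability.Complexity
  Literature.Computability.QuantumComplexity Literature.Computability.QuantumComplexity.ClassicalSimulation
open Summit.QuantumAdvantage.QuantumAdvantage.Theses.SosSandwich
open scoped ENNReal

namespace SimTreePB

/-- **PB-AA in the tree's vocabulary.** The route's antecedent `PseudoBoundedAA` (inline `let ev … let avg …`)
is, definitionally, the influence bound: `∃ c C₀ > 0, ∀ N T p ε, 1 ≤ T → p ∈ K_T → 0 < ε ≤ Var[p] →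
∃ i, C₀ (ε/T)^c ≤ Inf_i[p]` with `PseudoBounded`, `boolVariance`, `influence`. [folklore] -/
theorem pbInfluenceBound_of_pseudoBoundedAA (h : PseudoBoundedAA) :
    ∃ (c : ℕ) (C₀ : ℝ), 0 < C₀ ∧ ∀ (N T : ℕ) (p : MvPolynomial (Fin N) ℝ) (ε : ℝ), 1 ≤ T →
      PseudoBounded T p → 0 < ε → ε ≤ boolVariance p → ∃ i : Fin N, C₀ * (ε / T) ^ c ≤ influence i p := by
  obtain ⟨c, C₀, hC₀, H⟩ := h
  exact ⟨c, C₀, hC₀, fun N T p ε hT hp hε hv => H N T p ε hT hp hε hv⟩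

/-- **The query half of `stub_pbOracleSimulation`, from PB-AA alone.** Granted `PseudoBoundedAA` there are
`c, C₀ > 0` such that for every Clifford+T oracle family `F`, input `x` and `ε, δ ∈ (0,1]`, Aaronson–Ambainis'
simulation tree (parameters `θ = ε²δ/2`, `w = C₀(θ/d)^c`, budget `⌈8d/(wδ)⌉`, `d = 2·#gates + 1`) on the
acceptance polynomial `p_x` deviates from `Pr[F^A accepts x]` by more than `ε` with random-oracle probability
`≤ δ` (stub 1 `stub_oracleAcceptPseudoBounded` supplies `p_x ∈ K_{#gates}`). [cite: AaronsonAmbainis2014, Thm. 21 and proof of Thm. 23 (p. 14)] -/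
theorem queryHalf_of_pseudoBoundedAA (h : PseudoBoundedAA) :
    ∃ (c : ℕ) (C₀ : ℝ), 0 < C₀ ∧ ∀ (F : QCircuitFamily cliffordT) (x : List Bool) (ε δ : ℝ),
      0 < ε → ε ≤ 1 → 0 < δ → δ ≤ 1 →
        randomOracleMeasure {A : Set (List Bool) | ε <
            |(simTree (ε ^ 2 * δ / 2) (C₀ * ((ε ^ 2 * δ / 2) / thm23Degree F x) ^ c)
                (Nat.ceil (8 * (thm23Degree F x : ℝ) /
                  ((C₀ * ((ε ^ 2 * δ / 2) / thm23Degree F x) ^ c) * δ))) (acceptPoly F x)).eval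
                (oracleBits F x A) - F.acceptProbOn A x|} ≤ ENNReal.ofReal δ := by
  obtain ⟨c, C₀, hC₀, HPB⟩ := pbInfluenceBound_of_pseudoBoundedAA h
  exact ⟨c, C₀, hC₀, fun F x ε δ hε hε1 hδ hδ1 =>
    measure_simTree_acceptPoly_deviation_le_pb F x hC₀ HPB (stub_oracleAcceptPseudoBounded F x) hε hε1 hδ hδ1⟩

/-- **The thresholded claim (apx) for the explicit trees, from PB-AA alone**: granted `PseudoBoundedAA` there
are `c, C₀ > 0` such that for every Clifford+T oracle family `F` and input `x` of length `n ≥ 1`, the event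
"the `BQP` promise holds for `F^A` at `x` but `[ (simTreeOn c C₀ F x)(A) ≥ 1/2 ]` is not the promised answer"
has random-oracle probability `< 1/n³`. [cite: AaronsonAmbainis2014, Thm. 23 (proof, p. 14: claim (apx))] -/
theorem apxThreshold_of_pseudoBoundedAA (h : PseudoBoundedAA) :
    ∃ (c : ℕ) (C₀ : ℝ), 0 < C₀ ∧ ∀ (F : QCircuitFamily cliffordT) (x : List Bool), 1 ≤ x.length →
      randomOracleMeasure {A : Set (List Bool) |
          (2 / 3 ≤ F.acceptProbOn A x ∧
              decide (1 / 2 ≤ (simTreeOn c C₀ F x).eval (oracleBits F x A)) ≠ true) ∨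
            (F.acceptProbOn A x ≤ 1 / 3 ∧
              decide (1 / 2 ≤ (simTreeOn c C₀ F x).eval (oracleBits F x A)) ≠ false)} <
        ENNReal.ofReal (1 / (x.length : ℝ) ^ 3) := by
  obtain ⟨c, C₀, hC₀, HPB⟩ := pbInfluenceBound_of_pseudoBoundedAA h
  exact ⟨c, C₀, hC₀, fun F x hn =>
    measure_simTreeOn_threshold_lt_pb F x hC₀ HPB (stub_oracleAcceptPseudoBounded F x) hn⟩

end SimTreePB

end Summit.QuantumAdvantage.QuantumAdvantage.Cruxes.TransferPB.Birth

end
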